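import Summits.QuantumFields.BalabanUV.T4Continuum.Support.ShellMeasureLandauHolonomyWeight

/-!
# `T4Continuum.ShellMeasureLandauWeightLocal` — row S70 «END-II-loc», file 1: END-II's weight-side binder `hGW` with
# PER-PLAQUETTE read-out constants `κ_w(p)` (the slot through which LOCALITY enters the LD chain)
(cell `pub-balaban`, sub-cell `t4`, spine estimate NE7c (node U5b); NE7c ROUND-2 crew, unit
`b2b-balaban-t4-ne7c-formalise-leaf-01` gen 6, owner table `LEAVES-NE7c-P1.md` v3.0 row S70 (CLAIM journal l.16173);
ADDITIVE — imports the LD chain's file (B) `ShellMeasureLandauHolonomyWeight` (leaf-02 lineage, p214220) ONLY and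
re-runs its two theorems with `κ_w : 𝔭 → ℝ` in place of a uniform `κ_w`; nothing of the chain is restated or modified;
[folklore]; 0 `def`, 0 `def … : Prop`, 0 sorry, 0 citations)

HONEST FRAMING.  Finite four-torus programme, rung (B)+1 only — NOT infinite volume, NOT a mass gap, NOT the Clay
problem, NOT summit progress; (B), `BetaPertHyp`, (B^μ) not consumed.  NE7c (`T4IndicatorShell.ShellWeightBound`) is
NOT PRINTED and NOT PROVED; «NE7c ⇐ the named binders»; (M1) realized ≠ NE7c (c3).  Nothing printed is asserted: the
equation numbers below LOCATE the displayed SHAPES of binders, they are not citations.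

WHY (owner FINDING F-ne7cp1-g30-1, GAPS l.25103; WALL v1.9 §3 W-h).  END-II of record
(`ShellMeasureLandauHolonomyPrint.slotAC_realized_su2_landauChart_print`) feeds `ShellMeasureLevelAssembly` p-UNIFORM
letter data `s̄_p = m_w κ_w z̄`, `L̄_p = 3 m_w κ_w z̄∕(Rad − 1)` — ONE read-out constant `κ_w` for every weight plaquette —
so its slot constant `D ∝ Σ_{p∈P_w} L̄_p·4s̄_p = #P_w·(…)` is VOLUME-EXTENSIVE at a live level, where `P_w` must hold
every fine plaquette of the action.  What makes the true ray cost O(1) is LOCALITY: a weight read-out `ℓ ∈ ℓw p` is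
BLIND off the bonds of `p`, and the exponent field's response to the block variables DECAYS away from the block, so
the honest letter constant is PER PLAQUETTE, `κ_w(p) ≲ κ_w·e^{−δ′·dist(p, block)}` — S69 `ShellMeasurePinnedNorm`
(B) `norm_readOut_le_of_blind` once `𝒴` carries the pinned norm.  `ShellMeasureLevelAssembly.slotAntiConcentration_
of_levelData` and the E2′-level END `ShellMeasureLandauHolonomyClamp.slotAC_realized_su2_of_levelData_cube_contOn`
ALREADY take per-plaquette `sw`∕`lw`∕`dw`; the uniformity sits only in file (B)'s `weightWord_of_consistentCurves` ∕
`hGW_landau_chartRay`.  THIS FILE re-runs exactly those two with per-plaquette constants: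
* §1 **`weightWord_of_consistentCurves_local`** — (B) §1 with a per-plaquette letter bound `‖ℓ (Z_x σ)‖ ≤ a p` on the
  disc (`ℓ ∈ ℓw p`) in place of `‖ℓ Y‖ ≤ κ‖Y‖` + `‖Z_x σ‖ ≤ z̄`: sizes `s̄_p = m·a_p`, `L̄_p = m·3a_p∕(Rad − 1)`, `d̄_p = 0`.
* §2 **`hGW_landau_chartRay_local`** — (B) §3 VERBATIM except `κ_w : 𝔭 → ℝ`
  (`hℓw : ∀ p ∈ P_w, ∀ ℓ ∈ ℓw p, ∀ Y, ‖ℓ Y‖ ≤ κ_w p·‖Y‖`): END-II's `hGW` for the DEFINED Landau weight words with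
  `s̄_p = m_w·κ_w(p)·z̄`, `L̄_p = m_w·3κ_w(p)z̄∕(r_Φ∕S − 1)`, `z̄ = (ε₄ + B₀b) + 4C₂B₀(ε₄ + B₀b)²` (the chain's
  `landauCurve_along` + `reality_of_readOuts` BY NAME).
Files 2–3 of the row carry these through the END (`…threeSided_local`, `…print_local`) and conclude with S69
`slotAntiConcentration_pinned` (D VOLUME-FREE under `κ_w(p) ≤ κ̄_w e^{−δ′ϖ(p)}`, `Σ_p e^{−δ′ϖ(p)} ≤ K`).  THE TWO NORMS
enter at INSTANTIATION (node O ∕ the locality road's dictionary), not here: `𝒴` := S69's pinned space, `κ_w(p)` by S69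
(B), the operator binders `h𝒢`∕`hH₁`∕`hH` in the pinned currency by S69 (A) over DISPLAYED kernel-decay binders
((3.133) ∕ [5] Thm 3.3 ∕ (46) TYPE), the nonlinear binders `hW`∕`hCq` in the pinned currency from decaying DERIVATIVE
kernels ((73) TYPE) — all DISPLAYED, none discharged.  NOTHING in the countdown moves; NE7c NOT PROVED; spine PROVED
0∕9.  HONEST DEPENDENCY (cell): continuum YM on T⁴ ⇐ BetaPertH ∧ nine spine estimates (0/9 proved); BetaPertH ⇐ (D1) ∧
(D4) ∧ CAP+tail; G-an2-4 gates asym, D1 and NE2/3/4.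
-/

noncomputable section

open Set Metric NormedSpace

namespace Summit.QuantumFields.BalabanUV.T4Continuum.ShellMeasureLandauWeightLocal

open Literature.MathematicalPhysics.QuantumFieldTheory.Balaban1983to89
open B11Prop6Scheme (Prop4Hyp)
open ShellMeasureWilsonTrace (TraceData)
open ShellMeasureWilsonMoving (MLetter mwordEval mdFro sSum lSum)
open ShellMeasureLevelAssembly (good_moving_of_bondData)
open ShellMeasureLandauExponent (currentData_zero)
open ShellMeasureLandauHolonomy (solAt landauExp)
open ShellMeasureLandauHolonomyChart (holOf holOf_apply cplx ofReal_smul_cplx rayData_chart)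
open ShellMeasureLandauHolonomyWeight (sSum_map_uniform lSum_map_uniform map_fst_map_uniform mdFro_map_moving
  mwordEval_map_moving landauCurve_along reality_of_readOuts)

variable {E : Type*} [AddCommGroup E] [Module ℝ E]
variable {𝒴 𝒴' 𝒳 𝒵 : Type*} [NormedAddCommGroup 𝒴] [NormedSpace ℂ 𝒴] [NormedAddCommGroup 𝒴'] [NormedSpace ℂ 𝒴']
  [NormedAddCommGroup 𝒳] [NormedSpace ℂ 𝒳] [NormedAddCommGroup 𝒵] [NormedSpace ℂ 𝒵]
variable {A : Type*} [NormedRing A] [NormedAlgebra ℂ A] [CompleteSpace A]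

/-! ## §1 `hGW` from ray-consistent holomorphic curves with PER-PLAQUETTE letter bounds -/

/-- **END-II's `hGW` WITH PER-PLAQUETTE LETTER BOUNDS.**  As `ShellMeasureLandauHolonomyWeight.weightWord_of_
consistentCurves`, but the letters of plaquette `p` are bounded on the disc by their OWN constant: `‖ℓ (Z_x σ)‖ ≤ a p`
for `ℓ ∈ ℓw p`, `‖σ‖ < Rad` (in the locality road: `a p = κ_w e^{−δ′ϖ(p)}·z_pin`, a read-out blind off `p` against the
pinned size of the exponent field).  CONCLUSION: END-II's `hGW` for `G p := holOf (ℓw p) Z` with `s̄_p = m·a_p`,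
`L̄_p = m·3a_p∕(Rad − 1)`, `d̄_p = 0` (`ShellMeasureLevelAssembly.good_moving_of_bondData` per letter). [folklore] -/
theorem weightWord_of_consistentCurves_local (T : TraceData A) {𝔭 : Type*} {W : Set E} {Pw : Finset 𝔭}
    (ℓw : 𝔭 → List (𝒴 →L[ℂ] A)) {m : ℕ} (hlen : ∀ p ∈ Pw, (ℓw p).length ≤ m) (Z : E → 𝒴) {Rad : ℝ}
    (hRad1 : 1 < Rad) (Zc : E → ℂ → 𝒴) (hZd : ∀ x ∈ W, DifferentiableOn ℂ (Zc x) (ball 0 Rad))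
    {a : 𝔭 → ℝ} (ha : ∀ p ∈ Pw, 0 ≤ a p)
    (hZℓ : ∀ x ∈ W, ∀ σ ∈ ball (0 : ℂ) Rad, ∀ p ∈ Pw, ∀ ℓ ∈ ℓw p, ‖ℓ (Zc x σ)‖ ≤ a p)
    (hray : ∀ x ∈ W, ∀ c : ℝ, 0 ≤ c → c ≤ 1 → Zc x c = Z (c • x))
    (hreal : ∀ x ∈ W, ∀ c : ℝ, 0 ≤ c → c ≤ 1 → ∀ p ∈ Pw, ∀ ℓ ∈ ℓw p,
      T.τ (ℓ (Z (c • x))) = 0 ∧ ‖exp (ℓ (Z (c • x)))‖ ≤ 1) :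
    ∀ x ∈ W, ∀ p ∈ Pw, ∃ gw : List (MLetter A × ℝ × ℝ), (∀ y ∈ gw, y.1.Good T.τ y.2.1 y.2.2) ∧
      sSum gw ≤ m * a p ∧ lSum gw ≤ m * (3 * a p / (Rad - 1)) ∧ mdFro (gw.map Prod.fst) ≤ 0 ∧
      ∀ c : ℝ, 0 ≤ c → c ≤ 1 → mwordEval c (gw.map Prod.fst) = holOf (ℓw p) Z (c • x) := by
  intro x hx p hp
  have hap : 0 ≤ a p := ha p hp
  have hL0 : 0 ≤ 3 * a p / (Rad - 1) := div_nonneg (by positivity) (by linarith)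
  have hlen' : ((ℓw p).length : ℝ) ≤ m := Nat.cast_le.2 (hlen p hp)
  refine ⟨(ℓw p).map fun ℓ => (MLetter.moving fun c : ℝ => ℓ (Zc x c), a p, 3 * a p / (Rad - 1)),
    fun y hy => ?_, ?_, ?_, ?_, fun c hc0 hc1 => ?_⟩
  · -- every letter is admissible: (an) on the disc with its plaquette's own bound + reality on the segment
    obtain ⟨ℓ, hℓm, rfl⟩ := List.mem_map.1 hy
    have h := good_moving_of_bondData T (𝓧 := fun σ => ℓ (Zc x σ)) (a := a p) hRad1
      (ℓ.differentiable.comp_differentiableOn (hZd x hx)) (fun w hw => hZℓ x hx w hw p hp ℓ hℓm)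
      (fun c hc0 hc1 => by
        show T.τ (ℓ (Zc x c)) = 0
        rw [hray x hx c hc0 hc1]; exact (hreal x hx c hc0 hc1 p hp ℓ hℓm).1)
      (fun c hc0 hc1 => by
        show ‖exp (ℓ (Zc x c))‖ ≤ 1
        rw [hray x hx c hc0 hc1]; exact (hreal x hx c hc0 hc1 p hp ℓ hℓm).2)
    simpa only [mul_one] using h
  · rw [sSum_map_uniform]; exact mul_le_mul_of_nonneg_right hlen' hap
  · rw [lSum_map_uniform]; exact mul_le_mul_of_nonneg_right hlen' hL0
  · rw [map_fst_map_uniform, mdFro_map_moving]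
  · rw [map_fst_map_uniform, mwordEval_map_moving, holOf_apply, hray x hx c hc0 hc1]

/-! ## §2 The chart-ray instance: END-II's `hGW` for the defined Landau weight words, per-plaquette `κ_w(p)` -/

section ChartRay

variable {n : ℕ} {ℬ : Type*} [NormedAddCommGroup ℬ] [NormedSpace ℂ ℬ] [CompleteSpace 𝒴] [CompleteSpace 𝒳]
  {𝒢 : 𝒵 →L[ℂ] 𝒴} {W𝒱 : 𝒴 → 𝒵} {B₀ C₄ a₃ : ℝ}

/-- **END-II's `hGW` ON THE CHART-RAY INSTANCE WITH PER-PLAQUETTE READ-OUT CONSTANTS** —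
`ShellMeasureLandauHolonomyWeight.hGW_landau_chartRay` VERBATIM except that the weight read-outs of plaquette `p` carry
their own constant, `‖ℓ Y‖ ≤ κ_w(p)·‖Y‖` for `ℓ ∈ ℓw p` (in the locality road, with `𝒴` the pinned space of S69:
`κ_w(p) ≤ κ̄_w·e^{−δ′ϖ(p)}` by `ShellMeasurePinnedNorm.norm_readOut_le_of_blind`).  Binders otherwise as there: (P2)
`h𝒢`; (P4) `hW`; (118)∕(121) at `a = B₀b`; (103) `hH₁`; (75) `hΦd`∕`hΦ0`∕`hΦ`; (44)+[4] Prop. 7 `hCq`∕`hCd`; scaling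
`hι`; (46) `hH`; (54)-smallness `hq`∕`hRC`; the real structure and the unitarity TYPE `hℓr`.  CONCLUSION: END-II's
`hGW` for the DEFINED weight words with `s̄_p = m_w·κ_w(p)·z̄`, `L̄_p = m_w·3κ_w(p)z̄∕(r_Φ∕S − 1)`, `d̄_p = 0`,
`z̄ = (ε₄ + B₀b) + 4C₂B₀(ε₄ + B₀b)²`.  NOT an instance of Bałaban's minimiser; NE7c NOT PROVED. [folklore] -/
theorem hGW_landau_chartRay_local (T : TraceData A) {𝔭 : Type*} {W : Set (Fin n → ℝ)} {Pw : Finset 𝔭} {S : ℝ}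
    (hS : 0 < S) (hWS : W ⊆ closedBall (0 : Fin n → ℝ) S)
    (h𝒢 : ∀ f, ‖𝒢 f‖ ≤ B₀ * ‖f‖) (hW : Prop4Hyp W𝒱 C₄ a₃) (hB₀ : 0 < B₀) (hC₄ : 0 ≤ C₄)
    {b ε₄ : ℝ} (hε₄ : 0 ≤ ε₄) (hdom : 2 * (ε₄ + B₀ * b) ≤ a₃)
    (hself : B₀ * C₄ * (ε₄ + B₀ * b) ^ 2 ≤ ε₄) (hcontr : 4 * B₀ * C₄ * (ε₄ + B₀ * b) < 1)
    (H₁ : ℬ →L[ℂ] 𝒴) (hH₁ : ∀ B, ‖H₁ B‖ ≤ B₀ * ‖B‖)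
    {Φ : (Fin n → ℂ) → ℬ} {rΦ : ℝ} (hΦd : DifferentiableOn ℂ Φ (ball 0 rΦ)) (hΦ0 : Φ 0 = 0)
    (hΦ : ∀ z ∈ ball (0 : Fin n → ℂ) rΦ, ‖Φ z‖ < b) (hSr : S < rΦ)
    {C : 𝒴' → 𝒳} {C₂ R : ℝ} (hC₂ : 0 ≤ C₂) (hCq : ∀ Z : 𝒴', ‖Z‖ < R → ‖C Z‖ ≤ C₂ * ‖Z‖ ^ 2)
    (hCd : DifferentiableOn ℂ C (ball 0 R)) (ι : 𝒴 →L[ℂ] 𝒴') (hι : ∀ Y, ‖ι Y‖ ≤ ‖Y‖) (H : 𝒳 →L[ℂ] 𝒴)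
    (hH : ∀ X, ‖H X‖ ≤ B₀ * ‖X‖) (hq : 9 * C₂ * B₀ * (ε₄ + B₀ * b) < 1) (hRC : 3 * (ε₄ + B₀ * b) ≤ R)
    -- weight read-outs with PER-PLAQUETTE constants
    (ℓw : 𝔭 → List (𝒴 →L[ℂ] A)) {κw : 𝔭 → ℝ} (hκw : ∀ p ∈ Pw, 0 ≤ κw p)
    (hℓw : ∀ p ∈ Pw, ∀ ℓ ∈ ℓw p, ∀ Y, ‖ℓ Y‖ ≤ κw p * ‖Y‖)
    {m : ℕ} (hlen : ∀ p ∈ Pw, (ℓw p).length ≤ m)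
    -- the real structure (file (A) of the chain) and the unitarity TYPE of the weight read-outs
    (𝓡𝒴 : AddSubgroup 𝒴) (h𝓡𝒴 : IsClosed (𝓡𝒴 : Set 𝒴)) (𝓡𝒵 : AddSubgroup 𝒵) (𝓡𝒴' : AddSubgroup 𝒴')
    (𝓡𝒳 : AddSubgroup 𝒳) (h𝓡𝒳 : IsClosed (𝓡𝒳 : Set 𝒳)) (𝓡ℬ : AddSubgroup ℬ)
    (h𝒢r : ∀ f ∈ 𝓡𝒵, 𝒢 f ∈ 𝓡𝒴) (hWr : ∀ Y ∈ 𝓡𝒴, W𝒱 Y ∈ 𝓡𝒵) (hιr : ∀ Y ∈ 𝓡𝒴, ι Y ∈ 𝓡𝒴')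
    (hHr : ∀ X ∈ 𝓡𝒳, H X ∈ 𝓡𝒴) (hCr : ∀ Z ∈ 𝓡𝒴', C Z ∈ 𝓡𝒳) (hH₁r : ∀ B ∈ 𝓡ℬ, H₁ B ∈ 𝓡𝒴)
    (hΦr : ∀ y : Fin n → ℝ, ‖y‖ ≤ S → Φ (cplx y) ∈ 𝓡ℬ)
    (hℓr : ∀ p ∈ Pw, ∀ ℓ ∈ ℓw p, ∀ Y ∈ 𝓡𝒴, T.τ (ℓ Y) = 0 ∧ ‖exp (ℓ Y)‖ ≤ 1) :
    ∀ x ∈ W, ∀ p ∈ Pw, ∃ gw : List (MLetter A × ℝ × ℝ), (∀ y ∈ gw, y.1.Good T.τ y.2.1 y.2.2) ∧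
      sSum gw ≤ m * (κw p * ((ε₄ + B₀ * b) + B₀ * (4 * C₂ * (ε₄ + B₀ * b) ^ 2))) ∧
      lSum gw ≤ m * (3 * (κw p * ((ε₄ + B₀ * b) + B₀ * (4 * C₂ * (ε₄ + B₀ * b) ^ 2))) / (rΦ / S - 1)) ∧
      mdFro (gw.map Prod.fst) ≤ 0 ∧
      ∀ c : ℝ, 0 ≤ c → c ≤ 1 → mwordEval c (gw.map Prod.fst) =
        holOf (ℓw p) (fun y => landauExp C ι H (4 * C₂ * (ε₄ + B₀ * b) ^ 2)
          (solAt 𝒢 0 W𝒱 ε₄ (0 : 𝒵) (H₁ (Φ (cplx y))) + H₁ (Φ (cplx y)))) (c • x) := by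
  have hRad1 : 1 < rΦ / S := by rw [lt_div_iff₀ hS]; linarith
  have hRad : 0 < rΦ / S := one_pos.trans hRad1
  have ha : 0 < B₀ * b := by
    have hb : 0 < b := (norm_nonneg _).trans_lt (hΦ 0 (mem_ball_self (hS.trans hSr)))
    exact mul_pos hB₀ hb
  have hz : 0 ≤ (ε₄ + B₀ * b) + B₀ * (4 * C₂ * (ε₄ + B₀ * b) ^ 2) := by positivity
  -- the scheme at `Λ = 0`, `J = 0`
  have hΛ : ∀ Y : 𝒴, ‖(0 : 𝒴 →L[ℂ] 𝒴) Y‖ ≤ 0 * ‖Y‖ := fun Y => by simp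
  have hself' : B₀ * 0 + 0 * (ε₄ + B₀ * b) + B₀ * C₄ * (ε₄ + B₀ * b) ^ 2 ≤ ε₄ := by simpa using hself
  have hcontr' : 0 + 4 * B₀ * C₄ * (ε₄ + B₀ * b) < 1 := by simpa using hcontr
  -- per window point: the coarse-field ray family through the chart map and the Landau curve along it (the chain)
  have hray := fun x (hx : x ∈ W) =>
    rayData_chart H₁ hH₁ hB₀ hΦd hΦ0 hΦ hS (mem_closedBall_zero_iff.1 (hWS hx))
  have hcurve := fun x (hx : x ∈ W) =>
    landauCurve_along h𝒢 hΛ hW hB₀.le hC₄ le_rfl hε₄ hdom hself' hcontr' hRad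
      (currentData_zero (𝒵 := 𝒵) (rΦ / S)).1 (hray x hx).1 (currentData_zero (𝒵 := 𝒵) (rΦ / S)).2.1
      (hray x hx).2.2.1 rfl (hray x hx).2.1 hC₂ hCq hCd ι hι H hH hq hRC
  exact weightWord_of_consistentCurves_local T ℓw hlen
    (fun y => landauExp C ι H (4 * C₂ * (ε₄ + B₀ * b) ^ 2)
      (solAt 𝒢 0 W𝒱 ε₄ (0 : 𝒵) (H₁ (Φ (cplx y))) + H₁ (Φ (cplx y))))
    hRad1
    (fun x σ => landauExp C ι H (4 * C₂ * (ε₄ + B₀ * b) ^ 2)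
      (solAt 𝒢 0 W𝒱 ε₄ (0 : 𝒵) (H₁ (Φ (σ • cplx x))) + H₁ (Φ (σ • cplx x))))
    (fun x hx => (hcurve x hx).1) (fun p hp => mul_nonneg (hκw p hp) hz)
    (fun x hx σ hσ p hp ℓ hℓm => (hℓw p hp ℓ hℓm _).trans
      (mul_le_mul_of_nonneg_left ((hcurve x hx).2 σ hσ) (hκw p hp)))
    (fun _ _ _ _ _ => by simp only [ofReal_smul_cplx])
    (reality_of_readOuts T hWS h𝒢 hW hB₀ hC₄ hε₄ hdom hself hcontr H₁ hH₁ hΦ hSr hC₂ hCq hCd ι hι H hH hq hRC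
      𝓡𝒴 h𝓡𝒴 𝓡𝒵 𝓡𝒴' 𝓡𝒳 h𝓡𝒳 𝓡ℬ h𝒢r hWr hιr hHr hCr hH₁r hΦr ℓw hℓr)

end ChartRay

end Summit.QuantumFields.BalabanUV.T4Continuum.ShellMeasureLandauWeightLocal

end
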